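import Summits.KontsevichZagierPeriods.KontsevichZagierPeriods.Theorems.SoloInformedTelescopeDomains
import HarnessLib
import HarnessLib.Audit

/-!
# SoloInformed — the six representations of the weight-3 Möbius telescope

Solo programme `solo-KontsevichZagierPeriods-informed`, session s45 (PART XVI, the mixed Tate
sector). Coordinates on `ℝ³`: `y = x₀` (passive), `u = x₁`, `w = x₂`; `O = (0,1)³`.

| name | domain | integrand |
|---|---|---|
| `R₁` | `D₁ = O ∩ {w < u}` | `f₁ = 1/((1−yu)(1−w))` |
| `R₂` | `O` | `S = 1/((1−yu)(1−yuw))` |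
| `B`  | `D₁` | `g = w/((1−yuw)(1−w))` |
| `V`  | `O` | `f_V = w/((1−yuw)(1−yuw²))` |
| `R♯` | `D♯ = O ∩ {w² < u < w}` | `f₁` |
| `A = R₂|_{D₁}`, `C = R₂|_{D₂}` | `D₂ = O ∩ {u < w}` | `S` |

Integrability: `R₁, R₂, B` by domination by a weight `∏ (1 − xᵢ)^{−eᵢ}`, `eᵢ < 1`
(`SoloInformedTelescopeKit`, `SoloInformedTelescopeDomains`); `V` and `R♯` by transport along
`Φ(y,u,w) = (y,uw,w)` from `C` and `B`. The moves are in `SoloInformedTelescopeMoves`.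

References: M. Kontsevich, D. Zagier, *Periods* (2001), §1.2 [KontsevichZagier2001];
M. Kaneko, S. Yamamoto, arXiv:1605.03117, Thm 1.1 (the integral–series identity whose
`k = (1)` case the telescope realises inside the KZ rules).
-/

noncomputable section

open MeasureTheory Set MvPolynomial
open Literature.ModelTheory.ExponentialFields Literature.NumberTheory.Transcendental
open Literature.NumberTheory.Transcendental.KZ

namespace Summit.KontsevichZagierPeriods.KontsevichZagierPeriods.Theorems

/-! ## 5. The representations -/

/-- Semialgebraicity of a quotient integrand `p/q` written as a real function. -/
theorem soloInformed_isSemialgebraicFunOn_quot3 {D : Set (Fin 3 → ℝ)} (hD : IsSemialgebraic ℚ D)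
    (p q : MvPolynomial (Fin 3) ℚ) (f : (Fin 3 → ℝ) → ℝ)
    (hq : ∀ x ∈ D, (aeval x q : ℝ) ≠ 0) (hf : ∀ x ∈ D, (aeval x p : ℝ) / aeval x q = f x) :
    IsSemialgebraicFunOn ℚ D f :=
  (isSemialgebraicFunOn_aeval_div_aeval hD p q hq).congr hf

/-- **`R₁ = [D₁, 1/((1−yu)(1−w))]`.** -/
def soloInformedTelR1 : IntegralRep 3 where
  domain := soloInformedTelD1
  integrand := soloInformedTelF1
  isSemialgebraic_domain := isSemialgebraic_soloInformedTelD1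
  isSemialgebraicFunOn_integrand :=
    soloInformed_isSemialgebraicFunOn_quot3 isSemialgebraic_soloInformedTelD1 1
      ((1 - X 0 * X 1) * (1 - X 2)) _
      (fun x hx => by
        simpa using (mul_pos (soloInformed_one_sub_yu_pos hx.1) (soloInformed_one_sub_w_pos hx.1)).ne')
      fun x _ => by simp [soloInformedTelF1]
  integrableOn :=
    soloInformed_integrableOn_of_le_W3 soloInformed_measurableSet_telD1 soloInformedTelD1_subset
      (soloInformed_continuousOn_telF1.mono soloInformedTelD1_subset) soloInformedTelE1
      soloInformedTelE1_lt_one 1 fun x hx => by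
        rw [abs_of_pos (soloInformedTelF1_pos hx.1), one_mul]; exact soloInformedTelF1_le_W3 hx

/-- **`R₂ = [(0,1)³, 1/((1−yu)(1−yuw))]`.** -/
def soloInformedTelR2 : IntegralRep 3 where
  domain := soloInformedOpenCube 3
  integrand := soloInformedTelS
  isSemialgebraic_domain := isSemialgebraic_soloInformedOpenCube 3
  isSemialgebraicFunOn_integrand :=
    soloInformed_isSemialgebraicFunOn_quot3 (isSemialgebraic_soloInformedOpenCube 3) 1
      ((1 - X 0 * X 1) * (1 - X 0 * X 1 * X 2)) _
      (fun x hx => by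
        simpa using (mul_pos (soloInformed_one_sub_yu_pos hx) (soloInformed_one_sub_yuw_pos hx)).ne')
      fun x _ => by simp [soloInformedTelS]
  integrableOn :=
    soloInformed_integrableOn_of_le_W3 soloInformed_measurableSet_openCube3 Subset.rfl
      soloInformed_continuousOn_telS soloInformedTelE2 soloInformedTelE2_lt_one 1 fun x hx => by
        rw [abs_of_pos (soloInformedTelS_pos hx), one_mul]; exact soloInformedTelS_le_W3 hx

/-- **`B = [D₁, w/((1−yuw)(1−w))]`.** -/
def soloInformedTelB : IntegralRep 3 where
  domain := soloInformedTelD1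
  integrand := soloInformedTelG
  isSemialgebraic_domain := isSemialgebraic_soloInformedTelD1
  isSemialgebraicFunOn_integrand :=
    soloInformed_isSemialgebraicFunOn_quot3 isSemialgebraic_soloInformedTelD1 (X 2)
      ((1 - X 0 * X 1 * X 2) * (1 - X 2)) _
      (fun x hx => by
        simpa using (mul_pos (soloInformed_one_sub_yuw_pos hx.1) (soloInformed_one_sub_w_pos hx.1)).ne')
      fun x _ => by simp [soloInformedTelG]
  integrableOn :=
    soloInformed_integrableOn_of_le_W3 soloInformed_measurableSet_telD1 soloInformedTelD1_subset
      (soloInformed_continuousOn_telG.mono soloInformedTelD1_subset) soloInformedTelE1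
      soloInformedTelE1_lt_one 1 fun x hx => by
        rw [abs_of_pos (soloInformedTelG_pos hx.1), one_mul]
        exact (soloInformedTelG_le_F1 hx.1).trans (soloInformedTelF1_le_W3 hx)

/-- `A = R₂|_{D₁}`. -/
def soloInformedTelA : IntegralRep 3 :=
  soloInformedTelR2.restrict soloInformedTelD1 isSemialgebraic_soloInformedTelD1 soloInformedTelD1_subset

/-- `C = R₂|_{D₂}`. -/
def soloInformedTelC : IntegralRep 3 :=
  soloInformedTelR2.restrict soloInformedTelD2 isSemialgebraic_soloInformedTelD2 soloInformedTelD2_subset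

/-- The pull-back identity `S(Φx) · w = f_V(x)`. -/
theorem soloInformedTelS_phi (x : Fin 3 → ℝ) :
    soloInformedTelS (soloInformedTelPhi x) * x 2 = soloInformedTelFV x := by
  simp only [soloInformedTelS, soloInformedTelFV, soloInformedTelPhi_zero, soloInformedTelPhi_one,
    soloInformedTelPhi_two]
  ring

/-- The pull-back identity `f₁(Φx) · w = g(x)`. -/
theorem soloInformedTelF1_phi (x : Fin 3 → ℝ) :
    soloInformedTelF1 (soloInformedTelPhi x) * x 2 = soloInformedTelG x := by
  simp only [soloInformedTelF1, soloInformedTelG, soloInformedTelPhi_zero, soloInformedTelPhi_one,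
    soloInformedTelPhi_two]
  ring

/-- **`V = [(0,1)³, w/((1−yuw)(1−yuw²))]`**, integrable by transport from `C` along `Φ`. -/
def soloInformedTelV : IntegralRep 3 where
  domain := soloInformedOpenCube 3
  integrand := soloInformedTelFV
  isSemialgebraic_domain := isSemialgebraic_soloInformedOpenCube 3
  isSemialgebraicFunOn_integrand :=
    soloInformed_isSemialgebraicFunOn_quot3 (isSemialgebraic_soloInformedOpenCube 3) (X 2)
      ((1 - X 0 * X 1 * X 2) * (1 - X 0 * X 1 * X 2 * X 2)) _
      (fun x hx => by
        simpa using (mul_pos (soloInformed_one_sub_yuw_pos hx) (soloInformed_one_sub_yuww_pos hx)).ne')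
      fun x _ => by simp [soloInformedTelFV]
  integrableOn := by
    have h := (soloInformed_integrableOn_image_polyMap_iff soloInformedTelPhiPoly
      soloInformed_measurableSet_openCube3 soloInformed_injOn_telPhi soloInformedTelS).1 (by
        rw [show soloInformedPolyMap soloInformedTelPhiPoly = soloInformedTelPhi from rfl,
          soloInformed_image_telPhi_cube]
        exact soloInformedTelC.integrableOn)
    refine h.congr_fun (fun x hx => ?_) soloInformed_measurableSet_openCube3
    dsimp only
    rw [soloInformed_det_telPhi, abs_of_pos (hx 2).1, mul_comm]
    exact soloInformedTelS_phi x

/-- **`R♯ = [D♯, 1/((1−yu)(1−w))]`**, integrable by transport from `B` along `Φ`. -/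
def soloInformedTelRs : IntegralRep 3 where
  domain := soloInformedTelDs
  integrand := soloInformedTelF1
  isSemialgebraic_domain := isSemialgebraic_soloInformedTelDs
  isSemialgebraicFunOn_integrand :=
    soloInformed_isSemialgebraicFunOn_quot3 isSemialgebraic_soloInformedTelDs 1
      ((1 - X 0 * X 1) * (1 - X 2)) _
      (fun x hx => by
        simpa using (mul_pos (soloInformed_one_sub_yu_pos hx.1) (soloInformed_one_sub_w_pos hx.1)).ne')
      fun x _ => by simp [soloInformedTelF1]
  integrableOn := by
    have h := (soloInformed_integrableOn_image_polyMap_iff soloInformedTelPhiPoly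
      soloInformed_measurableSet_telD1 (soloInformed_injOn_telPhi.mono soloInformedTelD1_subset)
      soloInformedTelF1).2 (by
        refine soloInformedTelB.integrableOn.congr_fun (fun x hx => ?_) soloInformed_measurableSet_telD1
        show soloInformedTelG x = _
        rw [soloInformed_det_telPhi, abs_of_pos (hx.1 2).1, mul_comm]
        exact (soloInformedTelF1_phi x).symm)
    rwa [show soloInformedPolyMap soloInformedTelPhiPoly = soloInformedTelPhi from rfl,
      soloInformed_image_telPhi_D1] at h

end Summit.KontsevichZagierPeriods.KontsevichZagierPeriods.Theorems
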